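import Mathlib
import Summits.NavierStokesRegularity.NavierStokesRegularity.Theorems.FilamentSkeletonRssStadiumCauchyNumerator

/-!
# Cauchy–log tangent deviation off the real line (`TangentSkeletonNearStraightL`, stmt-NavierStokesRegularity-23320, registered stub
# `stub_stripPropagation` — the `Rb`-FREE control of `F′(x+it) − X′(x)` used with `StadiumPairPositivity` / `StadiumSegmentPositivity`)

`F : ℂ → ℂ³` complex-differentiable on an open `U` with `‖F′‖ ≤ M` on `U` (the stadium; `M = 2` in the stub).  Along the vertical segment
`u ↦ x + iu`, `0 ≤ u ≤ t < R`, suppose the shrinking closed discs `closedBall (x+iu) (R−u)` stay inside `U` (true with `R = ` the distance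
from `x` to the complement of the stadium: horizontal room to the stadium end and vertical room `cs√Γ`).  Then
* `norm_deriv_vertical_sub_le` (first order): `‖F′(x+it) − F′(x)‖ ≤ M·log(R/(R−t))` — Cauchy's estimate `‖F″(x+iu)‖ ≤ M/(R−u)`
  (`Theorems.StadiumCauchyNumerator.norm_deriv_deriv_le_of_closedBall`) integrated along the segment;
* `abs_re_deriv_vertical_sub_le` (second order, REAL PART): if moreover `F` is real on a real interval around `x`, then
  `|Re F′ᵢ(x+it) − Re F′ᵢ(x)| ≤ 2M·(log(R/(R−t)) − t/R)` — `F″(x)` is real, so `Im F″(x+iu) = Im(F″(x+iu) − F″(x))` is bounded through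
  Cauchy's estimate for the THIRD derivative `‖F‴‖ ≤ 2M/(R−v)²` (`Complex.norm_iteratedDeriv_le_of_forall_mem_sphere_norm_le`), and
  `Re(F′(x+it) − F′(x)) = −∫₀ᵗ Im F″(x+iu) du`.
At `t/R = 1/8` (output half-width `cs√Γ/8`, bulk) with `M = 2`: first order `≤ 0.267`, real part `≤ 0.034`; at `t/R = 1/7` (end descents):
`0.308` / `0.045` (sup norm; `×√3` for Euclidean) — independent of the tangent oscillation `Rb`.  HONEST FRAMING: a tool for a HYPOTHETICAL
filament skeleton on the NEGATIVE side of a MODEL route; nothing here bears on Navier–Stokes regularity or blow-up.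
`--supports stmt-NavierStokesRegularity-23320`.
-/

set_option linter.dupNamespace false

noncomputable section

namespace Summit.NavierStokesRegularity.NavierStokesRegularity.Theorems.StadiumTangentDeviation

open Set Metric MeasureTheory intervalIntegral
open Summit.NavierStokesRegularity.NavierStokesRegularity.Theorems.StadiumCauchyNumerator

/-- Cauchy's estimate for the THIRD derivative of a map with bounded first derivative: `‖F‴(c)‖ ≤ 2M/R²` when `‖F′‖ ≤ M` on an open
`U ⊇ closedBall c R`. [folklore] -/
theorem norm_deriv_three_le_of_closedBall {U : Set ℂ} (hU : IsOpen U) {F : ℂ → (Fin 3 → ℂ)} (hF : DifferentiableOn ℂ F U)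
    {M : ℝ} (hM : ∀ z ∈ U, ‖deriv F z‖ ≤ M) {c : ℂ} {R : ℝ} (hR : 0 < R) (hsub : closedBall c R ⊆ U) :
    ‖deriv (deriv (deriv F)) c‖ ≤ 2 * M / R ^ 2 := by
  have hdF : DifferentiableOn ℂ (deriv F) U := ((hF.analyticOnNhd hU).deriv).differentiableOn
  have hd : DiffContOnCl ℂ (deriv F) (ball c R) := by
    refine DifferentiableOn.diffContOnCl ?_
    rw [closure_ball c hR.ne']
    exact hdF.mono hsub
  have h := Complex.norm_iteratedDeriv_le_of_forall_mem_sphere_norm_le 2 hR hd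
    fun z hz => hM z (hsub (sphere_subset_closedBall hz))
  have h2 : iteratedDeriv 2 (deriv F) = deriv (deriv (deriv F)) := by
    rw [iteratedDeriv_succ, iteratedDeriv_one]
  rw [h2] at h
  have h3 : ((Nat.factorial 2 : ℕ) : ℝ) = 2 := by norm_num [Nat.factorial]
  simpa [h3] using h

/-- The vertical path `u ↦ x + iu` and its derivative. [folklore] -/
theorem hasDerivAt_vertical (x : ℝ) (u : ℝ) :
    HasDerivAt (fun u : ℝ => (x : ℂ) + (u : ℂ) * Complex.I) Complex.I u := by
  have h1 := (((hasDerivAt_id u).ofReal_comp).mul_const Complex.I).const_add (x : ℂ)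
  simpa using h1

/-- Integration of a bound along the vertical segment: if `G` is complex-differentiable on an open `U` containing `x + iu`,
`0 ≤ u ≤ t`, with `‖G′(x+iu)‖ ≤ g(u)` there for a `g` continuous on `[0,t]`, then `‖G(x+it) − G(x)‖ ≤ ∫₀ᵗ g`. [folklore] -/
theorem norm_vertical_sub_le_integral {U : Set ℂ} (hU : IsOpen U) {G : ℂ → (Fin 3 → ℂ)} (hG : DifferentiableOn ℂ G U)
    {x t : ℝ} (ht : 0 ≤ t) (hmem : ∀ u ∈ Icc (0:ℝ) t, (x : ℂ) + (u : ℂ) * Complex.I ∈ U)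
    {g : ℝ → ℝ} (hg : ContinuousOn g (Icc (0:ℝ) t))
    (hbound : ∀ u ∈ Icc (0:ℝ) t, ‖deriv G ((x : ℂ) + (u : ℂ) * Complex.I)‖ ≤ g u) :
    ‖G ((x : ℂ) + (t : ℂ) * Complex.I) - G (x : ℂ)‖ ≤ ∫ u in (0:ℝ)..t, g u := by
  have hIcc : uIcc (0:ℝ) t = Icc 0 t := uIcc_of_le ht
  have hGcont : ContinuousOn (deriv G) U := ((hG.analyticOnNhd hU).deriv).continuousOn
  have hpath_cont : Continuous fun u : ℝ => (x : ℂ) + (u : ℂ) * Complex.I :=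
    continuous_const.add (Complex.continuous_ofReal.mul continuous_const)
  have hder : ∀ u ∈ uIcc (0:ℝ) t, HasDerivAt (fun u : ℝ => G ((x : ℂ) + (u : ℂ) * Complex.I))
      (Complex.I • deriv G ((x : ℂ) + (u : ℂ) * Complex.I)) u := by
    intro u hu
    rw [hIcc] at hu
    have hGu : HasDerivAt G (deriv G ((x : ℂ) + (u : ℂ) * Complex.I)) ((x : ℂ) + (u : ℂ) * Complex.I) :=
      (hG.differentiableAt (hU.mem_nhds (hmem u hu))).hasDerivAt
    exact hGu.scomp u (hasDerivAt_vertical x u)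
  have hcont : ContinuousOn (fun u : ℝ => Complex.I • deriv G ((x : ℂ) + (u : ℂ) * Complex.I)) (uIcc (0:ℝ) t) := by
    rw [hIcc]
    exact (hGcont.comp hpath_cont.continuousOn fun u hu => hmem u hu).const_smul Complex.I
  have hftc := intervalIntegral.integral_eq_sub_of_hasDerivAt hder (hcont.intervalIntegrable)
  have h0 : (fun u : ℝ => G ((x : ℂ) + (u : ℂ) * Complex.I)) 0 = G (x : ℂ) := by simp
  have heq : G ((x : ℂ) + (t : ℂ) * Complex.I) - G (x : ℂ) =
      ∫ u in (0:ℝ)..t, Complex.I • deriv G ((x : ℂ) + (u : ℂ) * Complex.I) := by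
    rw [hftc]; simp
  rw [heq]
  refine intervalIntegral.norm_integral_le_of_norm_le ht ?_ ((hg.mono (by rw [← hIcc])).intervalIntegrable_of_Icc ht)
  refine Filter.Eventually.of_forall fun u hu => ?_
  have hu' : u ∈ Icc (0:ℝ) t := Ioc_subset_Icc_self hu
  rw [norm_smul, Complex.norm_I, one_mul]
  exact hbound u hu'

/-- `∫₀ᵗ M/(R−u) du = M·log(R/(R−t))` for `0 ≤ t < R`. [folklore] -/
theorem integral_inv_sub_eq_log {M R t : ℝ} (ht : 0 ≤ t) (htR : t < R) :
    ∫ u in (0:ℝ)..t, M / (R - u) = M * Real.log (R / (R - t)) := by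
  have hIcc : uIcc (0:ℝ) t = Icc 0 t := uIcc_of_le ht
  have hR : 0 < R := lt_of_le_of_lt ht htR
  have hder : ∀ u ∈ uIcc (0:ℝ) t, HasDerivAt (fun u : ℝ => -M * Real.log (R - u)) (M / (R - u)) u := by
    intro u hu
    rw [hIcc] at hu
    have hpos : 0 < R - u := by linarith [hu.2]
    have h1 : HasDerivAt (fun u : ℝ => R - u) (-1) u := (hasDerivAt_id u).const_sub R
    have h2 := (h1.log hpos.ne').const_mul (-M)
    exact h2.congr_deriv (by ring)
  have hcont : ContinuousOn (fun u : ℝ => M / (R - u)) (uIcc (0:ℝ) t) := by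
    rw [hIcc]
    exact continuousOn_const.div (continuousOn_const.sub continuousOn_id) fun u hu => by
      have : 0 < R - u := by linarith [hu.2]
      exact this.ne'
  rw [intervalIntegral.integral_eq_sub_of_hasDerivAt hder hcont.intervalIntegrable]
  have hRt : 0 < R - t := by linarith
  simp only [sub_zero]
  rw [Real.log_div hR.ne' hRt.ne']
  ring

/-- `∫₀ᵗ 2M/(R−u)² du = 2M·(1/(R−t) − 1/R)` for `0 ≤ t < R`. [folklore] -/
theorem integral_inv_sub_sq_eq {M R t : ℝ} (ht : 0 ≤ t) (htR : t < R) :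
    ∫ u in (0:ℝ)..t, 2 * M / (R - u) ^ 2 = 2 * M * (1 / (R - t) - 1 / R) := by
  have hIcc : uIcc (0:ℝ) t = Icc 0 t := uIcc_of_le ht
  have hR : 0 < R := lt_of_le_of_lt ht htR
  have hder : ∀ u ∈ uIcc (0:ℝ) t, HasDerivAt (fun u : ℝ => 2 * M * (R - u)⁻¹) (2 * M / (R - u) ^ 2) u := by
    intro u hu
    rw [hIcc] at hu
    have hpos : 0 < R - u := by linarith [hu.2]
    have h1 : HasDerivAt (fun u : ℝ => R - u) (-1) u := (hasDerivAt_id u).const_sub R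
    have h2 := (h1.inv hpos.ne').const_mul (2 * M)
    exact h2.congr_deriv (by ring)
  have hcont : ContinuousOn (fun u : ℝ => 2 * M / (R - u) ^ 2) (uIcc (0:ℝ) t) := by
    rw [hIcc]
    exact continuousOn_const.div ((continuousOn_const.sub continuousOn_id).pow 2) fun u hu => by
      have : 0 < R - u := by linarith [hu.2]
      positivity
  rw [intervalIntegral.integral_eq_sub_of_hasDerivAt hder hcont.intervalIntegrable]
  simp only [sub_zero, one_div]
  ring

/-- `∫₀ᵗ 2M(1/(R−u) − 1/R) du = 2M·(log(R/(R−t)) − t/R)` for `0 ≤ t < R`. [folklore] -/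
theorem integral_inv_sub_sub_eq {M R t : ℝ} (ht : 0 ≤ t) (htR : t < R) :
    ∫ u in (0:ℝ)..t, 2 * M * (1 / (R - u) - 1 / R) = 2 * M * (Real.log (R / (R - t)) - t / R) := by
  have hIcc : uIcc (0:ℝ) t = Icc 0 t := uIcc_of_le ht
  have h1 : (fun u : ℝ => 2 * M * (1 / (R - u) - 1 / R)) = fun u => (2 * M) / (R - u) - 2 * M / R := by
    funext u; ring
  rw [h1]
  have hcont : ContinuousOn (fun u : ℝ => (2 * M) / (R - u)) (uIcc (0:ℝ) t) := by
    rw [hIcc]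
    exact continuousOn_const.div (continuousOn_const.sub continuousOn_id) fun u hu => by
      have : 0 < R - u := by linarith [hu.2]
      exact this.ne'
  rw [intervalIntegral.integral_sub hcont.intervalIntegrable intervalIntegrable_const,
    integral_inv_sub_eq_log ht htR, intervalIntegral.integral_const]
  simp only [sub_zero, smul_eq_mul]
  ring

/-- **First-order Cauchy–log deviation.**  `‖F′(x+it) − F′(x)‖ ≤ M·log(R/(R−t))` along a vertical segment with shrinking Cauchy discs
`closedBall (x+iu) (R−u) ⊆ U`, `0 ≤ u ≤ t < R`, when `‖F′‖ ≤ M` on the open set `U`. [folklore] -/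
theorem norm_deriv_vertical_sub_le {U : Set ℂ} (hU : IsOpen U) {F : ℂ → (Fin 3 → ℂ)} (hF : DifferentiableOn ℂ F U)
    {M : ℝ} (hM : ∀ w ∈ U, ‖deriv F w‖ ≤ M) {x t R : ℝ} (ht : 0 ≤ t) (htR : t < R)
    (hdisc : ∀ u ∈ Icc (0:ℝ) t, closedBall ((x : ℂ) + (u : ℂ) * Complex.I) (R - u) ⊆ U) :
    ‖deriv F ((x : ℂ) + (t : ℂ) * Complex.I) - deriv F (x : ℂ)‖ ≤ M * Real.log (R / (R - t)) := by
  have hGd : DifferentiableOn ℂ (deriv F) U := ((hF.analyticOnNhd hU).deriv).differentiableOn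
  have hmem : ∀ u ∈ Icc (0:ℝ) t, (x : ℂ) + (u : ℂ) * Complex.I ∈ U := fun u hu =>
    hdisc u hu (mem_closedBall_self (by linarith [hu.2]))
  have hg : ContinuousOn (fun u : ℝ => M / (R - u)) (Icc (0:ℝ) t) :=
    continuousOn_const.div (continuousOn_const.sub continuousOn_id) fun u hu => by
      have : 0 < R - u := by linarith [hu.2]
      exact this.ne'
  have hbound : ∀ u ∈ Icc (0:ℝ) t, ‖deriv (deriv F) ((x : ℂ) + (u : ℂ) * Complex.I)‖ ≤ M / (R - u) := fun u hu =>
    norm_deriv_deriv_le_of_closedBall hU hF hM (by linarith [hu.2]) (hdisc u hu)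
  have h := norm_vertical_sub_le_integral hU hGd ht hmem hg hbound
  rwa [integral_inv_sub_eq_log ht htR] at h

/-- Derivatives of a real map are real: if `G` is complex-differentiable at the points of a real interval `(a,b)` and takes real values there,
so does `G′`. [folklore] -/
theorem im_deriv_eq_zero_of_im_eq_zero {G : ℂ → (Fin 3 → ℂ)} {a b : ℝ}
    (hG : ∀ r ∈ Ioo a b, DifferentiableAt ℂ G (r : ℂ)) (hreal : ∀ r ∈ Ioo a b, ∀ i, (G r i).im = 0) :
    ∀ r ∈ Ioo a b, ∀ i, (deriv G r i).im = 0 := by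
  intro r hr i
  have hGd : HasDerivAt G (deriv G (r : ℂ)) (r : ℂ) := (hG r hr).hasDerivAt
  have h0 : HasDerivAt (fun y : ℝ => ((y : ℝ) : ℂ)) ((1 : ℝ) : ℂ) r := (hasDerivAt_id r).ofReal_comp
  have h1' := hGd.scomp r h0
  have h1 : HasDerivAt (fun y : ℝ => G (y : ℂ)) (deriv G (r : ℂ)) r := by
    have e : (((1 : ℝ) : ℂ) • deriv G (r : ℂ)) = deriv G (r : ℂ) := by rw [Complex.ofReal_one, one_smul]
    rw [e] at h1'
    exact h1'
  have h2 : HasDerivAt (fun y : ℝ => G (y : ℂ) i) (deriv G (r : ℂ) i) r := (hasDerivAt_pi.1 h1) i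
  have h3 := Complex.imCLM.hasFDerivAt.comp_hasDerivAt r h2
  have h4 : HasDerivAt (⇑Complex.imCLM ∘ fun y : ℝ => G (y : ℂ) i) (0 : ℝ) r := by
    refine (hasDerivAt_const r (0:ℝ)).congr_of_eventuallyEq ?_
    filter_upwards [Ioo_mem_nhds hr.1 hr.2] with y hy
    simp [hreal y hy i]
  have h5 := h3.unique h4
  simpa using h5

/-- **Second-order Cauchy–log deviation of the REAL part.**  If in addition `F` is real on a real interval `(a,b) ∋ x` contained in `U`,
then `|Re F′ᵢ(x+it) − Re F′ᵢ(x)| ≤ 2M·(log(R/(R−t)) − t/R)` for every component `i`. [folklore] -/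
theorem abs_re_deriv_vertical_sub_le {U : Set ℂ} (hU : IsOpen U) {F : ℂ → (Fin 3 → ℂ)} (hF : DifferentiableOn ℂ F U)
    {M : ℝ} (hM : ∀ w ∈ U, ‖deriv F w‖ ≤ M) {a b x t R : ℝ} (hx : x ∈ Ioo a b)
    (hab : ∀ r ∈ Ioo a b, (r : ℂ) ∈ U) (hreal : ∀ r ∈ Ioo a b, ∀ i, (F r i).im = 0)
    (ht : 0 ≤ t) (htR : t < R)
    (hdisc : ∀ u ∈ Icc (0:ℝ) t, closedBall ((x : ℂ) + (u : ℂ) * Complex.I) (R - u) ⊆ U) (i : Fin 3) :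
    |(deriv F ((x : ℂ) + (t : ℂ) * Complex.I) i).re - (deriv F (x : ℂ) i).re| ≤
      2 * M * (Real.log (R / (R - t)) - t / R) := by
  have hIcc : uIcc (0:ℝ) t = Icc 0 t := uIcc_of_le ht
  have hR : 0 < R := lt_of_le_of_lt ht htR
  set G : ℂ → (Fin 3 → ℂ) := deriv F with hGdef
  set G2 : ℂ → (Fin 3 → ℂ) := deriv G with hG2def
  have hGd : DifferentiableOn ℂ G U := ((hF.analyticOnNhd hU).deriv).differentiableOn
  have hG2d : DifferentiableOn ℂ G2 U := ((hGd.analyticOnNhd hU).deriv).differentiableOn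
  have hG2cont : ContinuousOn G2 U := hG2d.continuousOn
  have hmem : ∀ u ∈ Icc (0:ℝ) t, (x : ℂ) + (u : ℂ) * Complex.I ∈ U := fun u hu =>
    hdisc u hu (mem_closedBall_self (by linarith [hu.2]))
  -- `F″` is real at `x`
  have hGreal : ∀ r ∈ Ioo a b, ∀ i, (G r i).im = 0 :=
    im_deriv_eq_zero_of_im_eq_zero (fun r hr => hF.differentiableAt (hU.mem_nhds (hab r hr))) hreal
  have hG2real : ∀ i, (G2 x i).im = 0 :=
    im_deriv_eq_zero_of_im_eq_zero (fun r hr => hGd.differentiableAt (hU.mem_nhds (hab r hr))) hGreal x hx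
  -- Step 2: `|Im F″ᵢ(x+iu)| ≤ 2M(1/(R−u) − 1/R)` for `0 ≤ u ≤ t`
  have hstep2 : ∀ u ∈ Icc (0:ℝ) t, |(G2 ((x : ℂ) + (u : ℂ) * Complex.I) i).im| ≤ 2 * M * (1 / (R - u) - 1 / R) := by
    intro u hu
    have hu0 : 0 ≤ u := hu.1
    have huR : u < R := lt_of_le_of_lt hu.2 htR
    have hmem' : ∀ v ∈ Icc (0:ℝ) u, (x : ℂ) + (v : ℂ) * Complex.I ∈ U := fun v hv =>
      hmem v ⟨hv.1, hv.2.trans hu.2⟩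
    have hg : ContinuousOn (fun v : ℝ => 2 * M / (R - v) ^ 2) (Icc (0:ℝ) u) :=
      continuousOn_const.div ((continuousOn_const.sub continuousOn_id).pow 2) fun v hv => by
        have : 0 < R - v := by linarith [hv.2]
        positivity
    have hb3 : ∀ v ∈ Icc (0:ℝ) u, ‖deriv G2 ((x : ℂ) + (v : ℂ) * Complex.I)‖ ≤ 2 * M / (R - v) ^ 2 := fun v hv =>
      norm_deriv_three_le_of_closedBall hU hF hM (by linarith [hv.2]) (hdisc v ⟨hv.1, hv.2.trans hu.2⟩)
    have h := norm_vertical_sub_le_integral hU hG2d hu0 hmem' hg hb3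
    rw [integral_inv_sub_sq_eq hu0 huR] at h
    have him : (G2 ((x : ℂ) + (u : ℂ) * Complex.I) i).im =
        ((G2 ((x : ℂ) + (u : ℂ) * Complex.I) - G2 (x : ℂ)) i).im := by
      simp [Pi.sub_apply, Complex.sub_im, hG2real i]
    rw [him]
    exact ((Complex.abs_im_le_norm _).trans (norm_le_pi_norm _ i)).trans h
  -- Step 1: the real part of `F′ᵢ` along the vertical segment has derivative `−Im F″ᵢ`
  have hder : ∀ u ∈ uIcc (0:ℝ) t, HasDerivAt (⇑Complex.reCLM ∘ fun u : ℝ => G ((x : ℂ) + (u : ℂ) * Complex.I) i)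
      (-(G2 ((x : ℂ) + (u : ℂ) * Complex.I) i).im) u := by
    intro u hu
    rw [hIcc] at hu
    have hGu : HasDerivAt G (G2 ((x : ℂ) + (u : ℂ) * Complex.I)) ((x : ℂ) + (u : ℂ) * Complex.I) :=
      (hGd.differentiableAt (hU.mem_nhds (hmem u hu))).hasDerivAt
    have h1 := hGu.scomp u (hasDerivAt_vertical x u)
    have h2 : HasDerivAt (fun u : ℝ => G ((x : ℂ) + (u : ℂ) * Complex.I) i)
        (Complex.I * G2 ((x : ℂ) + (u : ℂ) * Complex.I) i) u := by
      have h := (hasDerivAt_pi.1 h1) i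
      simpa [Pi.smul_apply, smul_eq_mul] using h
    have h3 := Complex.reCLM.hasFDerivAt.comp_hasDerivAt u h2
    refine h3.congr_deriv ?_
    simp [Complex.mul_re]
  have hcontIm : ContinuousOn (fun u : ℝ => -(G2 ((x : ℂ) + (u : ℂ) * Complex.I) i).im) (uIcc (0:ℝ) t) := by
    rw [hIcc]
    have hpath_cont : Continuous fun u : ℝ => (x : ℂ) + (u : ℂ) * Complex.I :=
      continuous_const.add (Complex.continuous_ofReal.mul continuous_const)
    have hc : ContinuousOn (fun u : ℝ => G2 ((x : ℂ) + (u : ℂ) * Complex.I)) (Icc (0:ℝ) t) :=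
      hG2cont.comp hpath_cont.continuousOn fun u hu => hmem u hu
    exact ((Complex.continuous_im.comp_continuousOn ((continuous_apply i).comp_continuousOn hc))).neg
  have hftc := intervalIntegral.integral_eq_sub_of_hasDerivAt hder hcontIm.intervalIntegrable
  have heq : (deriv F ((x : ℂ) + (t : ℂ) * Complex.I) i).re - (deriv F (x : ℂ) i).re =
      ∫ u in (0:ℝ)..t, -(G2 ((x : ℂ) + (u : ℂ) * Complex.I) i).im := by
    rw [hftc]; simp [hGdef, Function.comp]
  rw [heq]
  have hg1 : ContinuousOn (fun u : ℝ => 2 * M * (1 / (R - u) - 1 / R)) (Icc (0:ℝ) t) := by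
    refine continuousOn_const.mul ((continuousOn_const.div (continuousOn_const.sub continuousOn_id) fun u hu => ?_).sub
      continuousOn_const)
    have : 0 < R - u := by linarith [hu.2]
    exact this.ne'
  have hnorm : ‖∫ u in (0:ℝ)..t, -(G2 ((x : ℂ) + (u : ℂ) * Complex.I) i).im‖ ≤
      ∫ u in (0:ℝ)..t, 2 * M * (1 / (R - u) - 1 / R) := by
    refine intervalIntegral.norm_integral_le_of_norm_le ht ?_ ((hg1.mono (by rw [← hIcc])).intervalIntegrable_of_Icc ht)
    refine Filter.Eventually.of_forall fun u hu => ?_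
    rw [Real.norm_eq_abs, abs_neg]
    exact hstep2 u (Ioc_subset_Icc_self hu)
  rw [Real.norm_eq_abs, integral_inv_sub_sub_eq ht htR] at hnorm
  exact hnorm

end Summit.NavierStokesRegularity.NavierStokesRegularity.Theorems.StadiumTangentDeviation

end
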